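import Summits.KontsevichZagierPeriods.Zeta5Search.LaiSweepShard

/-!
# `κ₃` sweep certificate — shard file 023 of 127 (shards 161–167 of 889)

HONEST FRAMING. Systematic search; no irrationality claim unless certified. This file only checks,
by `decide +kernel`, shards 161–167 of the order-cell sweep of the `κ₃` point `(74, 2180, 444; δ74)`
(engine `LaiSweepEngine`, soundness `LaiSweepJump/Free/Eval/Shard/Kappa3`; a shard is `⟨regime, n,
p, q, p', q', Lo, Up⟩`: `n` cells from `p/q` to `p'/q'` with integer rate sums in `[Lo, Up]`, `K =
128`, `D = 2^40`). It draws NO conclusion: only the capstone `LaiKappa3SweepCert`, which needs all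
127 shard files, does. Kernel cost of this file ≈ 560 cells × 0.3 s.
-/

namespace Summit.KontsevichZagierPeriods.Zeta5Search.Sweep

set_option maxHeartbeats 100000000 in
/-- Shard 161: 80 cells of regime B from `20/237` to `22/257`.
[cite: Lai2024BallRivoal, §4 Lemma 4.3] -/
theorem shard161 :
    Shard.check 128 (2^40)
      ⟨true, 80, 20, 237, 22, 257, 74974026088903, 75283740344659⟩ = true := by
  decide +kernel

set_option maxHeartbeats 100000000 in
/-- Shard 162: 80 cells of regime B from `22/257` to `31/357`.
[cite: Lai2024BallRivoal, §4 Lemma 4.3] -/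
theorem shard162 :
    Shard.check 128 (2^40)
      ⟨true, 80, 22, 257, 31, 357, 74943320261275, 75264374295983⟩ = true := by
  decide +kernel

set_option maxHeartbeats 100000000 in
/-- Shard 163: 80 cells of regime B from `31/357` to `26/295`.
[cite: Lai2024BallRivoal, §4 Lemma 4.3] -/
theorem shard163 :
    Shard.check 128 (2^40)
      ⟨true, 80, 31, 357, 26, 295, 77771655764078, 78120279598271⟩ = true := by
  decide +kernel

set_option maxHeartbeats 100000000 in
/-- Shard 164: 80 cells of regime B from `26/295` to `27/302`.
[cite: Lai2024BallRivoal, §4 Lemma 4.3] -/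
theorem shard164 :
    Shard.check 128 (2^40)
      ⟨true, 80, 26, 295, 27, 302, 74682926183983, 75024732617465⟩ = true := by
  decide +kernel

set_option maxHeartbeats 100000000 in
/-- Shard 165: 80 cells of regime B from `27/302` to `26/287`.
[cite: Lai2024BallRivoal, §4 Lemma 4.3] -/
theorem shard165 :
    Shard.check 128 (2^40)
      ⟨true, 80, 27, 302, 26, 287, 69140621284570, 69462352674687⟩ = true := by
  decide +kernel

set_option maxHeartbeats 100000000 in
/-- Shard 166: 80 cells of regime B from `26/287` to `8/87`.
[cite: Lai2024BallRivoal, §4 Lemma 4.3] -/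
theorem shard166 :
    Shard.check 128 (2^40)
      ⟨true, 80, 26, 287, 8, 87, 77769596194869, 78168535933531⟩ = true := by
  decide +kernel

set_option maxHeartbeats 100000000 in
/-- Shard 167: 80 cells of regime B from `8/87` to `11/118`.
[cite: Lai2024BallRivoal, §4 Lemma 4.3] -/
theorem shard167 :
    Shard.check 128 (2^40)
      ⟨true, 80, 8, 87, 11, 118, 71579787532649, 71936655109158⟩ = true := by
  decide +kernel

/-- The checked shards of this file, in order. [folklore] -/
def shards023 : List (CheckedShard 128 (2^40)) :=
  [⟨_, shard161⟩, ⟨_, shard162⟩, ⟨_, shard163⟩, ⟨_, shard164⟩, ⟨_, shard165⟩,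
    ⟨_, shard166⟩, ⟨_, shard167⟩]

end Summit.KontsevichZagierPeriods.Zeta5Search.Sweep
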